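import Summits.Ventures.Crystal3D.Theorems.StickyWulffConstantGenericWallFloorBarlowPrefix
import HarnessLib

/-!
# Orbit-freeness of cap-started walker families on a Barlow plate from the LINE STRUCTURE (no exit criterion)
# (crux `GenericWallFloor`, stmt-Ventures-19480, line `WallLedgerG`; lane T's flux family on two-rise plates, E3′ completed)

HONEST FRAMING. Venture `Summits/Ventures/Crystal3D` (cell `crystal3d-full`), helper `--supports` the crux `GenericWallFloor`
(stmt-Ventures-19480) of `route-Ventures-StickyWulffConstant`, registered line `WallLedgerG`, open stub `stub_twoSlabAdhesion`.
Rung credit only; F-C1 not moved; NOT the stub.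

`walkRun_injOn_of_exit` (`…CapStart`) makes a family end-injective when ONE height `H₀` separates all starts from all first
steps; a one-start-per-zigzag family on a plate whose two bilayer classes rise differently has no such `H₀` (F4 interface answer,
INBOX 2026-08-28T15:08:09Z (2)(iii)).  Here orbit-freeness — the hypothesis `hfree` of `walkRun_injOn_of_orbitFree` — is derived
from the prefix lemma `walkRun_canon_prefix` (`…BarlowPrefix`) instead: a walker launched at the canonical state of a start site
runs up ITS OWN zigzag while the zigzag stays in the complete region `R` (`n i` steps for start `i`), so during that time it stands
on another start's state only if that start lies on its zigzag prefix (excluded by `hlines`: one start per zigzag); afterwards it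
stands at or above its EXIT SITE (`walkRun_height_ge`, heights along `z` never decrease), which `hexit` places strictly above
every start.  Hence

* `walkRun_add'` — fuel composes;
* **`canon_orbitFree`** — `∀ i ≠ j ∈ T, ∀ k, walkRun X z k (start i) ≠ start j`;
* **`canon_walkRun_injOn`** — the family is end-injective (`walkRun_injOn_of_orbitFree`).
WHAT THIS IS NOT: no count, no sealing; the hypotheses `hin` (zigzag prefixes inside the complete window), `hlines`, `hexit`
(exit sites above all starts) are the consumer's geometry (crossing-site families: `…PeriodicLineCrossings`); F-C1 not moved.
-/

noncomputable section

namespace Summit.Ventures.Crystal3D.Theorems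

open Finset
open Literature.MathematicalPhysics.StatisticalMechanics
open scoped InnerProductSpace

variable {X : Finset (EuclideanSpace ℝ (Fin 3))}

/-- Fuel composes: `walkRun (a + b) = walkRun b ∘ walkRun a`. -/
theorem walkRun_add' (z : EuclideanSpace ℝ (Fin 3)) (a : ℕ) :
    ∀ (b : ℕ) (s : EuclideanSpace ℝ (Fin 3) × List WalkEntry), walkRun X z (a + b) s = walkRun X z b (walkRun X z a s)
  | 0, s => by simp
  | b + 1, s => by
    rw [← add_assoc, walkRun_succ' X z (a + b) s, walkRun_add' z a b s, ← walkRun_succ' X z b]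

section Moved

variable (σ : ℤ → ℤ) (L : EuclideanSpace ℝ (Fin 3) ≃ₗᵢ[ℝ] EuclideanSpace ℝ (Fin 3)) (s₀ z v₀ : EuclideanSpace ℝ (Fin 3))
  (canon : ℤ → EuclideanSpace ℝ (Fin 3) → EuclideanSpace ℝ (Fin 3) × List WalkEntry) (ms : ℤ → EuclideanSpace ℝ (Fin 3))

/-- **Orbit-freeness from the line structure.**  Canonical states / model steps as in `…BarlowPrefix`; a finite family `T` of
start sites `(mi i, ai i, bi i)` whose zigzag prefixes of lengths `n i` lie in the complete region `R` (`hin`), whose canonical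
start states are valid (`hvalid`), no start lying on another start's prefix (`hlines`, sites `0 … n i`), and every start strictly
below every exit site `n i` in `z`-height (`hexit`).  Then no start state lies on the forward orbit of another. -/
theorem canon_orbitFree (hσ : IsHaggSeq σ) (hX₁ : ∀ p ∈ X, ∀ q ∈ X, p ≠ q → 1 ≤ dist p q)
    {s₁ : EuclideanSpace ℝ (Fin 3)} (hs₁ : s₁ ∈ fccSlots) (hcert : ExactOnly 0 (fccSlots.filter fun w => 0 < ⟪w, s₁⟫_ℝ))
    (hz : ‖z‖ = 1) (hv₀ : v₀ ∈ fccSlots) (hv₀2 : v₀ 2 = Real.sqrt (2 / 3))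
    (hcanon₁ : ∀ m t, σ (m - 1) = 1 → canon m t = (t, [⟨L, v₀, 0⟩]))
    (hcanon₂ : ∀ m t, σ (m - 1) = -1 → canon m t =
      (t, [⟨twinFrame L (L (EuclideanSpace.single (2 : Fin 3) (1 : ℝ))),
            bestCapper (twinFrame L (L (EuclideanSpace.single (2 : Fin 3) (1 : ℝ)))) (L (EuclideanSpace.single (2 : Fin 3) (1 : ℝ))) z,
            L (EuclideanSpace.single (2 : Fin 3) (1 : ℝ))⟩, ⟨L, v₀, 0⟩]))
    (hms₁ : ∀ m, σ m = 1 → ms m = v₀)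
    (hms₂ : ∀ m, σ m = -1 → ms m =
      basalMirror (bestCapper (twinFrame L (L (EuclideanSpace.single (2 : Fin 3) (1 : ℝ)))) (L (EuclideanSpace.single (2 : Fin 3) (1 : ℝ))) z))
    (R : Set (EuclideanSpace ℝ (Fin 3)))
    (hR : ∀ m i j : ℤ, barlowPos 1 (Real.sqrt (2 / 3)) σ m i j ∈ R →
      ∀ q ∈ barlowStacking 1 (Real.sqrt (2 / 3)) σ, dist q (barlowPos 1 (Real.sqrt (2 / 3)) σ m i j) ≤ 1 → L q + s₀ ∈ X)
    {ι : Type*} (T : Finset ι) (mi ai bi : ι → ℤ) (n : ι → ℕ)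
    (hin : ∀ i ∈ T, ∀ k < n i,
      barlowPos 1 (Real.sqrt (2 / 3)) σ (mi i) (ai i) (bi i) + ∑ k' ∈ Finset.range k, ms (mi i + k') ∈ R)
    (hvalid : ∀ i ∈ T, WalkInv X z (canon (mi i) (L (barlowPos 1 (Real.sqrt (2 / 3)) σ (mi i) (ai i) (bi i)) + s₀)) ∧
      StackWF z (canon (mi i) (L (barlowPos 1 (Real.sqrt (2 / 3)) σ (mi i) (ai i) (bi i)) + s₀)).2)
    (hlines : ∀ i ∈ T, ∀ j ∈ T, i ≠ j → ∀ k ≤ n i,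
      barlowPos 1 (Real.sqrt (2 / 3)) σ (mi i) (ai i) (bi i) + ∑ k' ∈ Finset.range k, ms (mi i + k') ≠
        barlowPos 1 (Real.sqrt (2 / 3)) σ (mi j) (ai j) (bi j))
    (hexit : ∀ i ∈ T, ∀ j ∈ T,
      ⟪L (barlowPos 1 (Real.sqrt (2 / 3)) σ (mi j) (ai j) (bi j)) + s₀, z⟫_ℝ <
        ⟪L (barlowPos 1 (Real.sqrt (2 / 3)) σ (mi i) (ai i) (bi i) + ∑ k' ∈ Finset.range (n i), ms (mi i + k')) + s₀, z⟫_ℝ) :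
    ∀ i ∈ T, ∀ j ∈ T, i ≠ j → ∀ k,
      walkRun X z k (canon (mi i) (L (barlowPos 1 (Real.sqrt (2 / 3)) σ (mi i) (ai i) (bi i)) + s₀)) ≠
        canon (mi j) (L (barlowPos 1 (Real.sqrt (2 / 3)) σ (mi j) (ai j) (bi j)) + s₀) := by
  intro i hi j hj hij k hk
  -- positions of canonical states
  have hpos : ∀ m t, (canon m t).1 = t := by
    intro m t
    rcases hσ (m - 1) with h | h
    · rw [hcanon₁ m t h]
    · rw [hcanon₂ m t h]
  have hpref := fun k' (hk' : k' ≤ n i) =>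
    walkRun_canon_prefix σ L s₀ z v₀ canon ms hσ hX₁ hv₀ hv₀2 hcanon₁ hcanon₂ hms₁ hms₂ R hR k' (mi i) (ai i) (bi i)
      (fun k'' hk'' => hin i hi k'' (lt_of_lt_of_le hk'' hk'))
  by_cases hkn : k ≤ n i
  · -- still on the prefix: the positions would coincide
    obtain ⟨h1, -⟩ := hpref k hkn
    rw [h1] at hk
    have hp := congrArg Prod.fst hk
    rw [hpos, hpos] at hp
    have hp' := L.injective (add_right_cancel hp)
    exact hlines i hi j hj hij k hkn hp'
  · -- beyond the exit site: heights
    push Not at hkn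
    obtain ⟨d, hd⟩ := Nat.exists_eq_add_of_lt hkn
    obtain ⟨h1, -⟩ := hpref (n i) le_rfl
    have hrun : walkRun X z k (canon (mi i) (L (barlowPos 1 (Real.sqrt (2 / 3)) σ (mi i) (ai i) (bi i)) + s₀)) =
        walkRun X z (d + 1) (canon (mi i + (n i : ℕ))
          (L (barlowPos 1 (Real.sqrt (2 / 3)) σ (mi i) (ai i) (bi i) + ∑ k' ∈ Finset.range (n i), ms (mi i + k')) + s₀)) := by
      rw [hd, add_assoc, walkRun_add', h1]
    -- validity at the exit site, then monotone heights
    have hvalN := walkRun_valid hX₁ hs₁ hcert hz (n i) (hvalid i hi).1 (hvalid i hi).2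
    rw [h1] at hvalN
    have hge := walkRun_height_ge hX₁ hs₁ hcert hz (d + 1) _ hvalN.1
    rw [← hrun, hk, hpos, hpos] at hge
    have hlt := hexit i hi j hj
    linarith

/-- **End-injectivity of the family** (corollary via `walkRun_injOn_of_orbitFree`). -/
theorem canon_walkRun_injOn (hσ : IsHaggSeq σ) (hX₁ : ∀ p ∈ X, ∀ q ∈ X, p ≠ q → 1 ≤ dist p q)
    {s₁ : EuclideanSpace ℝ (Fin 3)} (hs₁ : s₁ ∈ fccSlots) (hcert : ExactOnly 0 (fccSlots.filter fun w => 0 < ⟪w, s₁⟫_ℝ))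
    (hz : ‖z‖ = 1) (hv₀ : v₀ ∈ fccSlots) (hv₀2 : v₀ 2 = Real.sqrt (2 / 3))
    (hcanon₁ : ∀ m t, σ (m - 1) = 1 → canon m t = (t, [⟨L, v₀, 0⟩]))
    (hcanon₂ : ∀ m t, σ (m - 1) = -1 → canon m t =
      (t, [⟨twinFrame L (L (EuclideanSpace.single (2 : Fin 3) (1 : ℝ))),
            bestCapper (twinFrame L (L (EuclideanSpace.single (2 : Fin 3) (1 : ℝ)))) (L (EuclideanSpace.single (2 : Fin 3) (1 : ℝ))) z,
            L (EuclideanSpace.single (2 : Fin 3) (1 : ℝ))⟩, ⟨L, v₀, 0⟩]))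
    (hms₁ : ∀ m, σ m = 1 → ms m = v₀)
    (hms₂ : ∀ m, σ m = -1 → ms m =
      basalMirror (bestCapper (twinFrame L (L (EuclideanSpace.single (2 : Fin 3) (1 : ℝ)))) (L (EuclideanSpace.single (2 : Fin 3) (1 : ℝ))) z))
    (R : Set (EuclideanSpace ℝ (Fin 3)))
    (hR : ∀ m i j : ℤ, barlowPos 1 (Real.sqrt (2 / 3)) σ m i j ∈ R →
      ∀ q ∈ barlowStacking 1 (Real.sqrt (2 / 3)) σ, dist q (barlowPos 1 (Real.sqrt (2 / 3)) σ m i j) ≤ 1 → L q + s₀ ∈ X)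
    {ι : Type*} (T : Finset ι) (mi ai bi : ι → ℤ) (n : ι → ℕ)
    (hin : ∀ i ∈ T, ∀ k < n i,
      barlowPos 1 (Real.sqrt (2 / 3)) σ (mi i) (ai i) (bi i) + ∑ k' ∈ Finset.range k, ms (mi i + k') ∈ R)
    (hvalid : ∀ i ∈ T, WalkInv X z (canon (mi i) (L (barlowPos 1 (Real.sqrt (2 / 3)) σ (mi i) (ai i) (bi i)) + s₀)) ∧
      StackWF z (canon (mi i) (L (barlowPos 1 (Real.sqrt (2 / 3)) σ (mi i) (ai i) (bi i)) + s₀)).2)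
    (hlines : ∀ i ∈ T, ∀ j ∈ T, i ≠ j → ∀ k ≤ n i,
      barlowPos 1 (Real.sqrt (2 / 3)) σ (mi i) (ai i) (bi i) + ∑ k' ∈ Finset.range k, ms (mi i + k') ≠
        barlowPos 1 (Real.sqrt (2 / 3)) σ (mi j) (ai j) (bi j))
    (hexit : ∀ i ∈ T, ∀ j ∈ T,
      ⟪L (barlowPos 1 (Real.sqrt (2 / 3)) σ (mi j) (ai j) (bi j)) + s₀, z⟫_ℝ <
        ⟪L (barlowPos 1 (Real.sqrt (2 / 3)) σ (mi i) (ai i) (bi i) + ∑ k' ∈ Finset.range (n i), ms (mi i + k')) + s₀, z⟫_ℝ)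
    (N : ℕ) :
    ∀ i ∈ T, ∀ j ∈ T,
      walkRun X z N (canon (mi i) (L (barlowPos 1 (Real.sqrt (2 / 3)) σ (mi i) (ai i) (bi i)) + s₀)) =
        walkRun X z N (canon (mi j) (L (barlowPos 1 (Real.sqrt (2 / 3)) σ (mi j) (ai j) (bi j)) + s₀)) → i = j :=
  walkRun_injOn_of_orbitFree hX₁ hs₁ hcert hz T
    (fun i => canon (mi i) (L (barlowPos 1 (Real.sqrt (2 / 3)) σ (mi i) (ai i) (bi i)) + s₀)) hvalid
    (canon_orbitFree σ L s₀ z v₀ canon ms hσ hX₁ hs₁ hcert hz hv₀ hv₀2 hcanon₁ hcanon₂ hms₁ hms₂ R hR T mi ai bi n hin hvalid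
      hlines hexit) N

end Moved

end Summit.Ventures.Crystal3D.Theorems

end
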